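import Literature.Barriers.ValiantsHypothesis.BIJL18Thm4OfPIT
import HarnessLib

/-!
# Bläser–Ikenmeyer–Jindal–Lysikov 2018, Thm 4 in POSITIVE characteristic, REDUCED to a randomised
# identity test MODULO THE CHARACTERISTIC for integer circuits

Theorem-only twin of `BIJL18Thm4OfPIT.lean` (the characteristic-`0` closer of the typed fact
`BIJL2018_thm4 K`, ECCC TR18-064 Thm 4, proof pp. 11–12). Over an infinite field `K` of
characteristic `p` the printed `∃BPP` verifier is the same machine (`BIJL18Thm4Machine.lean` writes
INTEGER circuit words, independent of `K`), but its two identity tests are read MODULO `p`: the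
chart-test word must compute a polynomial `≡ 0 (mod p)` and the evaluation word a value `≢ 0 (mod p)`
(`BIJL18Thm4VerifierSemantics.lean` §6: `lt_borderCompletionRank_of_tests_zmod`,
`exists_block_of_not_exists_numSatClauses_zmod`). This file proves:

* §1 soundness / completeness of the SAME verifier language `verifier n₀ B` when `B ∈ BPP` agrees,
  on circuit words, with "the integer circuit computes `0` modulo `p`", and
  `MAX2SATᶜ ∈ ∃·BPP` under the natural-proof hypothesis over `K`;
* §2 **`BIJL2018_thm4_of_randomizedPITMod`**: for any such `B ∈ BPP`, `BIJL2018_thm4 K` holds for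
  every infinite field `K` of characteristic `p`.

The remaining hypothesis — a `BPP` (indeed `coRP`) identity test modulo a fixed prime `p` for integer
circuit words (random point over a random extension `𝔽_p[X]/(f)`; Schwartz–Zippel in `𝔽_{p^k}`) —
is being formalised separately (val-lit t21 lineage, `RandomizedExtensionFieldZeroTest.lean`); with
it, `BIJL2018_thm4` follows for every infinite field by cases on the characteristic. No new facts.
HONEST FRAMING (val-lit): a 2018 CONDITIONAL barrier about the varieties `{\underline{CR} ≤ r}` with
a Boolean hypothesis, reduced inside the tree; nothing about `VP`; `VP ≠ VNP` is NOT proved.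

## References

* [BlaserIkenmeyerJindalLysikov2018] M. Bläser, C. Ikenmeyer, G. Jindal, V. Lysikov, *Generalized
  matrix completion and algebraic natural proofs*, STOC 2018 / ECCC TR18-064: Thm 4 (proof,
  ECCC pp. 11–12), Lemma 14, Lemma 16.
* [AroraBarak2009] S. Arora, B. Barak, *Computational Complexity: A Modern Approach*, CUP 2009,
  Def. 5.3 (∃·), §7.5.2, Lemma 7.5 / §A.6 (Schwartz–Zippel over finite fields).
* [GareyJohnsonStockmeyer1976] M. R. Garey, D. S. Johnson, L. Stockmeyer, TCS 1 (1976), Thm. 1.1.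
-/

noncomputable section

open MvPolynomial

namespace Literature.Barriers.ValiantsHypothesis

namespace BIJL2018Thm4

open Literature.Computability.AlgebraicComplexity Literature.Computability.Complexity ArithCircuit KIReduction
open _root_.Computability CodeFP Brick CNF MaxTwoSat BIJL18NPHard
open BILPS2019Cor42 (wordE evalCircuit eval_evalCircuit)
open scoped Literature.Computability.Complexity.Notation

universe u

/-! ### §1. Correctness of the verifier with an identity test modulo `p` -/

section CorrectnessModP

variable (p : ℕ) {B : Language Bool}

/-- **The two tests read modulo `p`**: acceptance of the two queries by a `B` agreeing, on circuit
words, with "the integer circuit computes `0` modulo `p`" means the chart-test circuit of the padded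
instance computes a polynomial `≡ 0 (mod p)` and its evaluation value is `≢ 0 (mod p)`.
[cite: BlaserIkenmeyerJindalLysikov2018, Thm. 4 (proof, steps (2)–(3))] -/
theorem tests_iff_zmod
    (hagree : ∀ (m : ℕ) (C : ArithCircuit ℤ (Fin m)), m ≤ (circuitWord m C).length →
      (circuitWord m C ∈ B ↔ map (Int.castRingHom (ZMod p)) C.eval = 0))
    (n₀ : ℕ) (φ : CNF ℕ) (b : ℕ) (y : List Bool) :
    (wordE (chartInst n₀ ((φ, b), y)) ∈ B ∧ wordE (evalInst n₀ ((φ, b), y)) ∉ B) ↔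
      (map (Int.castRingHom (ZMod p)) (chartCircuit (nOf (padCNF n₀ φ)) (tOf (padCNF n₀ φ))
          (2 * (padCNF n₀ φ).length - (b + n₀)) (readBlock y)).eval = 0 ∧
        ((eval (fun i : Fin (nPos (nOf (padCNF n₀ φ)) (tOf (padCNF n₀ φ))) =>
            entryFn (entries (padCNF n₀ φ)) i.1)
          (blockPoly (nPos (nOf (padCNF n₀ φ)) (tOf (padCNF n₀ φ))) (readBlock y)) : ℤ) : ZMod p) ≠ 0) := by
  rw [wordE_chartInst, wordE_evalInst, hagree _ _ (nVar_le_length_circuitWord _ _ _ _), hagree _ _ (Nat.zero_le _),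
    eval_evalCircuit, map_C, C_eq_zero, eq_intCast]
  rfl

/-- **SOUNDNESS of the verifier (characteristic `p`)**: an accepted pair has its instance outside
`MAX2SAT` (the rank is read over any infinite field `K` of characteristic `p`, given as an argument).
[cite: BlaserIkenmeyerJindalLysikov2018, Thm. 4 (proof: "The correctness follows from the construction")] -/
theorem not_mem_of_mem_verifier_zmod (K : Type u) [Field K] [CharP K p] [Infinite K]
    (hagree : ∀ (m : ℕ) (C : ArithCircuit ℤ (Fin m)), m ≤ (circuitWord m C).length →
      (circuitWord m C ∈ B ↔ map (Int.castRingHom (ZMod p)) C.eval = 0))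
    {n₀ : ℕ} {w y : List Bool} (h : boolPair w y ∈ verifier n₀ B) : w ∉ MAX2SAT := by
  rcases h with he | ⟨hm, hq⟩
  · have he' : easyFn (boolPair w y) = [true] := he
    rw [easyFn_apply] at he'
    simp only [List.cons.injEq, and_true, Bool.or_eq_true, Bool.not_eq_true', decide_eq_false_iff_not] at he'
    rcases he' with he' | he'
    · exact not_mem_MAX2SAT_of_not_canon he'
    · exact not_mem_MAX2SAT_of_easy he'
  · have hm' : mainFn (boolPair w y) = [true] := hm
    rw [mainFn_apply] at hm'
    simp only [List.cons.injEq, and_true, Bool.and_eq_true, decide_eq_true_eq] at hm'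
    obtain ⟨hcanon, hmain⟩ := hm'
    obtain ⟨h2, hb, -⟩ := (main_eq_true_iff _).1 hmain
    have hq' := (mem_twoQuery_iff n₀ B (boolPair w y)).1 hq
    rw [chartFn_apply, evalFn_apply] at hq'
    obtain ⟨hchart, heval⟩ := (tests_iff_zmod p hagree n₀ (decInst w).1 (decInst w).2 y).1 hq'
    have hno := not_exists_numSatClauses_of_tests_zmod p K n₀ h2 (by omega) (readBlock y) hchart heval
    intro hw
    rw [← hcanon, mem_MAX2SAT_iff'] at hw
    exact hno hw.2

/-- **COMPLETENESS of the verifier (characteristic `p`)** under the natural-proof hypothesis over `K`: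
an instance outside `MAX2SAT` has a short accepted witness. [cite: BlaserIkenmeyerJindalLysikov2018, Thm. 4 (proof: "Such a polynomial is guaranteed to exist by assumption")] -/
theorem exists_mem_verifier_zmod (K : Type u) [Field K] [CharP K p] [Infinite K]
    (hagree : ∀ (m : ℕ) (C : ArithCircuit ℤ (Fin m)), m ≤ (circuitWord m C).length →
      (circuitWord m C ∈ B ↔ map (Int.castRingHom (ZMod p)) C.eval = 0))
    {c₀ n₀ : ℕ}
    (hnat : ∀ n : ℕ, n₀ ≤ n → ∀ (m : ℕ) (A₀ : Matrix (Fin n) (Fin n) K) (A : Fin m → Matrix (Fin n) (Fin n) K)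
      (r : ℕ), (∀ v, tensorPoint K A₀ A v = 0 ∨ tensorPoint K A₀ A v = 1 ∨ tensorPoint K A₀ A v = -1) →
        r < borderCompletionRank A₀ A → ∃ q, IsBorderCRProof K A₀ A r (n ^ c₀ + c₀) q)
    {w : List Bool} (hw : w ∉ MAX2SAT) :
    ∃ y : List Bool, y.length ≤ (witnessPoly c₀ n₀).eval w.length ∧ boolPair w y ∈ verifier n₀ B := by
  have heasy : easyFn (boolPair w []) = [true] → ∃ y : List Bool,
      y.length ≤ (witnessPoly c₀ n₀).eval w.length ∧ boolPair w y ∈ verifier n₀ B :=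
    fun h => ⟨[], by simp, Or.inl h⟩
  by_cases hcanon : encodingCNFNat.encode (decInst w) = w
  swap
  · exact heasy (by rw [easyFn_apply]; simp [hcanon])
  cases hez : easy (decInst w)
  swap
  · exact heasy (by rw [easyFn_apply, hez]; simp)
  cases hmz : main (decInst w)
  · exact absurd (mem_MAX2SAT_of_not_easy_of_not_main hcanon hez hmz) hw
  obtain ⟨h2, hb, h1⟩ := (main_eq_true_iff _).1 hmz
  have hno : ¬ ∃ σ : ℕ → Bool, (decInst w).2 ≤ (decInst w).1.numSatClauses σ := fun hex =>
    hw (by rw [← hcanon, mem_MAX2SAT_iff']; exact ⟨h2, hex⟩)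
  obtain ⟨Bk, hBlen, hBidx, hchart, heval⟩ :=
    exists_block_of_not_exists_numSatClauses_zmod K p hnat (n₀ := n₀) h2 (by omega) hno
  refine ⟨encBlock Bk, ?_, Or.inr ⟨?_, ?_⟩⟩
  · refine (length_encBlock_le hBidx).trans ?_
    have hL : (decInst w).1.length ≤ w.length := by
      have h := length_le_length_encode (decInst w)
      rwa [hcanon] at h
    have hn : nOf (padCNF n₀ (decInst w).1) ≤ 2 * (w.length + n₀) := by
      rw [nOf, length_padCNF]; omega
    have h1 : Bk.length ≤ (2 * (w.length + n₀)) ^ c₀ + c₀ + 1 :=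
      hBlen.trans (by have := Nat.pow_le_pow_left hn c₀; omega)
    have h2 : nPos (nOf (padCNF n₀ (decInst w).1)) (tOf (padCNF n₀ (decInst w).1)) ≤
        (2 * (w.length + n₀) + 2) * (2 * (w.length + n₀)) ^ 2 := by
      unfold nPos tOf
      have ht : 2 * (padCNF n₀ (decInst w).1).length + 1 + 1 ≤ 2 * (w.length + n₀) + 2 := by
        rw [length_padCNF]; omega
      exact Nat.mul_le_mul ht (Nat.pow_le_pow_left hn 2)
    have hw' : (witnessPoly c₀ n₀).eval w.length = ((2 * (w.length + n₀)) ^ c₀ + c₀ + 1) *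
        (6 * ((2 * (w.length + n₀) + 2) * (2 * (w.length + n₀)) ^ 2 + (2 * (w.length + n₀)) ^ c₀ + c₀ + 1) + 58) := by
      simp [witnessPoly]
    rw [hw']
    exact Nat.mul_le_mul h1 (by omega)
  · show mainFn (boolPair w (encBlock Bk)) = [true]
    rw [mainFn_apply, hcanon, hmz]
    simp
  · refine (mem_twoQuery_iff n₀ B _).2 ?_
    rw [chartFn_apply, evalFn_apply]
    refine (tests_iff_zmod p hagree n₀ (decInst w).1 (decInst w).2 (encBlock Bk)).2 ?_
    simp only [readBlock_encBlock]
    exact ⟨hchart, heval⟩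

/-- **The complement of `MAX2SAT` is in `∃·BPP`** under the natural-proof hypothesis over `K`
(characteristic `p`) and a `BPP` identity test modulo `p` for circuit words.
[cite: BlaserIkenmeyerJindalLysikov2018, Thm. 4 (proof: "It is obviously an ∃BPP algorithm")] -/
theorem compl_MAX2SAT_mem_polyExists_BPP_zmod (K : Type u) [Field K] [CharP K p] [Infinite K] (hB : B ∈ BPP)
    (hagree : ∀ (m : ℕ) (C : ArithCircuit ℤ (Fin m)), m ≤ (circuitWord m C).length →
      (circuitWord m C ∈ B ↔ map (Int.castRingHom (ZMod p)) C.eval = 0))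
    {c₀ n₀ : ℕ}
    (hnat : ∀ n : ℕ, n₀ ≤ n → ∀ (m : ℕ) (A₀ : Matrix (Fin n) (Fin n) K) (A : Fin m → Matrix (Fin n) (Fin n) K)
      (r : ℕ), (∀ v, tensorPoint K A₀ A v = 0 ∨ tensorPoint K A₀ A v = 1 ∨ tensorPoint K A₀ A v = -1) →
        r < borderCompletionRank A₀ A → ∃ q, IsBorderCRProof K A₀ A r (n ^ c₀ + c₀) q) :
    MAX2SATᶜ ∈ polyExists BPP := by
  refine ⟨verifier n₀ B, verifier_mem_BPP n₀ B hB, witnessPoly c₀ n₀, fun w => ⟨fun hw => ?_, fun ⟨y, _, hy⟩ => ?_⟩⟩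
  · exact exists_mem_verifier_zmod p K hagree hnat hw
  · exact not_mem_of_mem_verifier_zmod p K hagree hy

end CorrectnessModP

/-! ### §2. The edge: Thm 4 in characteristic `p` from a randomised identity test modulo `p` -/

section EdgeModP

variable (p : ℕ) (K : Type u) [Field K] [CharP K p] [Infinite K]

/-- **BIJL Thm 4 (characteristic `p`) from a `BPP` identity test modulo `p` for integer circuit words**:
if some `B ∈ BPP` contains a circuit word `circuitWord m C` (with `m ≤ |circuitWord m C|`) exactly when
`C` computes a polynomial `≡ 0 (mod p)`, then `BIJL2018_thm4 K` holds for every infinite field `K` of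
characteristic `p`. Proof as printed, the identity tests being read modulo the characteristic.
[cite: BlaserIkenmeyerJindalLysikov2018, Thm. 4 (proof)] -/
theorem BIJL2018_thm4_of_randomizedPITMod {B : Language Bool} (hB : B ∈ BPP)
    (hagree : ∀ (m : ℕ) (C : ArithCircuit ℤ (Fin m)), m ≤ (circuitWord m C).length →
      (circuitWord m C ∈ B ↔ map (Int.castRingHom (ZMod p)) C.eval = 0)) :
    BIJL2018_thm4 K := by
  intro hco c₀ n₀
  by_contra h
  push Not at h
  refine hco (coNP_subset_polyExists_BPP_of_isNPHard_of_compl_mem MAX2SAT_isNPHard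
    (compl_MAX2SAT_mem_polyExists_BPP_zmod p K hB hagree (c₀ := c₀) (n₀ := n₀) fun n hn m A₀ A r hsign hlt => ?_))
  exact h n hn m A₀ A r hsign hlt

end EdgeModP

end BIJL2018Thm4

end Literature.Barriers.ValiantsHypothesis
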